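import Summits.ValiantsHypothesis.ValiantsHypothesis.Theorems.KPlusLogSqLawWeakLiftingTowerGraftTwoSidedThreeLetters
import Summits.ValiantsHypothesis.ValiantsHypothesis.Theorems.LacunarySymmetroidMatrixDescartesInertiaGlobalIndex
import Summits.ValiantsHypothesis.ValiantsHypothesis.Theorems.LacunarySymmetroidMatrixDescartesDetMultiplicityJordanChain
import Summits.ValiantsHypothesis.ValiantsHypothesis.Theorems.LacunarySymmetroidMatrixDescartesCensusSecularRolle

/-!
# Tower graft line — THE TWO-SIDED THREE-LETTER LAW, part B: census currency and the `2m` LAW for simple crossings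

Part B of `…TowerGraftTwoSidedThreeLetters.lean` (crux `stmt-ValiantsHypothesis-19561`, line (B) `tower_graft`, two-sided word
instrument; seat val-sym-lift-p3 g20, `--supports 19561`, NO stub claimed).  Part A proves the core Gram–Cauchy bound
`TwoSidedThree.card_posType_le_rank`: for `A, B ⪰ 0`, `J` symmetric and distinct positive kernel scales of `A + t^e J + t^{3e} B` of
positive type, the number of scales is `≤ rank B`.  This file puts it in the census currency of the tree
(`F(X) = ∑ₖ X^{dₖ} Sₖ` with `S = ![A, J, B]`, `d = ![d₀, d₀+e, d₀+3e]`, Rayleigh polynomials `P_u = ∑ₖ ⟨u,Sₖu⟩X^{dₖ}` and their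
derivative sign = the inertia kit's TYPE of a root) and draws the headline consequence:

* `rayleigh_deriv_eq` — type dictionary: at a kernel vector `u` of `F(t)`, `t·P_u′(t) = e·t^{d₀}·(2t^{3e}⟨u,Bu⟩ − ⟨u,Au⟩)`.
* `card_posType_roots_le` — any finite set of positive roots of `det F` each carrying a kernel vector of POSITIVE type has
  `≤ rank B ≤ m` elements (`A, B ⪰ 0`, `J` arbitrary symmetric, `e ≥ 1`, any `d₀`).
* `card_posRoots_le_two_mul` / `card_posRoots_finset_le_two_mul` — **THE `2m` LAW**: if `A ≻ 0`, `B ≻ 0` and every positive root of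
  `det F` is a SIMPLE CROSSING (one-dimensional kernel of definite type; = simple root by `Multiplicity.rootMultiplicity_det_pencil_eq_one`),
  then `det F` has at most `2m` positive roots counted with multiplicity, hence at most `2m` distinct positive roots — from the
  tree's GLOBAL INDEX FORMULA (`Inertia.global_index_formula`, seat mdr-p2: `ν(B) + N⁺ = ν(A) + N⁻`, `Z₊ = N⁺ + N⁻`) with
  `ν(A) = ν(B) = 0`, so `Z₊ = 2N⁺ ≤ 2·rank B`.

At `m = 3` on `(0,1,3)` the Descartes count with theory signs allows `8`; the located maximum is `6 = 2m` with types `+,−` alternating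
three and three.  HONEST FRAMING as in part A: a structural law for THREE letters on the supports `(d₀, d₀+e, d₀+3e)`; nothing on the
four-letter column, S4/S4b/S4d/S4f/S5, `TowerB`, `WeakLifting` in its window, Conjecture B, `MatrixDescartes` (18050) or `VP ≠ VNP`.
Def-free; axioms standard.

[folklore] via part A and the tree's inertia kit ([GohbergLancasterRodman2005, §12.4–12.5] sign characteristic).
-/

set_option linter.dupNamespace false
set_option autoImplicit false

namespace Summit.ValiantsHypothesis.ValiantsHypothesis.Theorems.KPlusLogSqLaw.TowerGraft

open Matrix
open scoped BigOperators

namespace TwoSidedThree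

/-! ## §4 Census currency: the pencil `X^d A + X^{d+e} J + X^{d+3e} B` and the `2m` law for simple crossings -/

section Census

open Polynomial
open Summit.ValiantsHypothesis.ValiantsHypothesis.Theorems.LacunarySymmetroidMatrixDescartes

variable {m : ℕ}

/-- the three-letter pencil on `(d, d+e, d+3e)` evaluated at `t` is `t^d · (A + t^e J + t^{3e} B)`. [folklore] -/
theorem pencil3_eval (A J B : Matrix (Fin m) (Fin m) ℝ) (d₀ e : ℕ) (t : ℝ) :
    (∑ k : Fin 3, t ^ (![d₀, d₀ + e, d₀ + 3 * e] k) • (![A, J, B] k))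
      = t ^ d₀ • (A + t ^ e • J + (t ^ e) ^ 3 • B) := by
  rw [Fin.sum_univ_three]
  simp only [Matrix.cons_val_zero, Matrix.cons_val_one, Matrix.cons_val]
  rw [show (t ^ e) ^ 3 = t ^ (3 * e) by rw [Nat.mul_comm 3 e, pow_mul], smul_add, smul_add, smul_smul, smul_smul,
    ← pow_add, ← pow_add]

/-- a kernel vector of the evaluated pencil at `t > 0` is a kernel vector of the reduced pencil `A + t^e J + t^{3e} B`. [folklore] -/
theorem reduced_kernel (A J B : Matrix (Fin m) (Fin m) ℝ) (d₀ e : ℕ) {t : ℝ} (ht : 0 < t) (u : Fin m → ℝ)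
    (hu : (∑ k : Fin 3, t ^ (![d₀, d₀ + e, d₀ + 3 * e] k) • (![A, J, B] k)) *ᵥ u = 0) :
    (A + t ^ e • J + (t ^ e) ^ 3 • B) *ᵥ u = 0 := by
  rw [pencil3_eval, Matrix.smul_mulVec] at hu
  exact (smul_eq_zero.mp hu).resolve_left (pow_ne_zero _ (ne_of_gt ht))

/-- **type dictionary**: at a kernel vector `u` of the pencil at `t > 0` (`e ≥ 1`), the derivative of the Rayleigh polynomial
`P_u = ∑ₖ ⟨u,Sₖu⟩X^{dₖ}` has the sign of `2t^{3e}⟨u,Bu⟩ − ⟨u,Au⟩`:  `t·P_u′(t) = e·t^d·(2t^{3e}⟨u,Bu⟩ − ⟨u,Au⟩)`. [folklore] -/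
theorem rayleigh_deriv_eq (A J B : Matrix (Fin m) (Fin m) ℝ) (d₀ e : ℕ) {t : ℝ} (ht : 0 < t) (u : Fin m → ℝ)
    (hu : (∑ k : Fin 3, t ^ (![d₀, d₀ + e, d₀ + 3 * e] k) • (![A, J, B] k)) *ᵥ u = 0) :
    t * (derivative (∑ k : Fin 3, C (u ⬝ᵥ ((![A, J, B] k) *ᵥ u)) * (X : ℝ[X]) ^ (![d₀, d₀ + e, d₀ + 3 * e] k))).eval t
      = (e : ℝ) * t ^ d₀ * (2 * (t ^ e) ^ 3 * (u ⬝ᵥ (B *ᵥ u)) - u ⬝ᵥ (A *ᵥ u)) := by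
  have hred := reduced_kernel A J B d₀ e ht u hu
  -- the Rayleigh trinomial vanishes at `t`
  have hray : u ⬝ᵥ (A *ᵥ u) + t ^ e * (u ⬝ᵥ (J *ᵥ u)) + (t ^ e) ^ 3 * (u ⬝ᵥ (B *ᵥ u)) = 0 := by
    have h := congrArg (fun w => u ⬝ᵥ w) hred
    simp only [dotProduct_zero, Matrix.add_mulVec, Matrix.smul_mulVec, dotProduct_add, dotProduct_smul,
      smul_eq_mul] at h
    linarith
  rw [← Multiplicity.form_derivative_eq_eval]
  rw [Fin.sum_univ_three]
  simp only [Matrix.cons_val_zero, Matrix.cons_val_one, Matrix.cons_val, Matrix.add_mulVec, Matrix.smul_mulVec,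
    dotProduct_add, dotProduct_smul, smul_eq_mul]
  have h0 := SecularRolle.mul_natCast_mul_pow_pred t d₀
  have h1 := SecularRolle.mul_natCast_mul_pow_pred t (d₀ + e)
  have h2 := SecularRolle.mul_natCast_mul_pow_pred t (d₀ + 3 * e)
  rw [show t * (↑d₀ * t ^ (d₀ - 1) * (u ⬝ᵥ (A *ᵥ u)) + ↑(d₀ + e) * t ^ (d₀ + e - 1) * (u ⬝ᵥ (J *ᵥ u))
        + ↑(d₀ + 3 * e) * t ^ (d₀ + 3 * e - 1) * (u ⬝ᵥ (B *ᵥ u)))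
      = (t * (↑d₀ * t ^ (d₀ - 1))) * (u ⬝ᵥ (A *ᵥ u)) + (t * (↑(d₀ + e) * t ^ (d₀ + e - 1))) * (u ⬝ᵥ (J *ᵥ u))
        + (t * (↑(d₀ + 3 * e) * t ^ (d₀ + 3 * e - 1))) * (u ⬝ᵥ (B *ᵥ u)) by ring, h0, h1, h2]
  push_cast
  have : t ^ (d₀ + e) = t ^ d₀ * t ^ e := pow_add _ _ _
  have : t ^ (d₀ + 3 * e) = t ^ d₀ * (t ^ e) ^ 3 := by rw [pow_add, Nat.mul_comm 3 e, pow_mul]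
  -- use the root relation to eliminate the `J` term
  have hJ : t ^ e * (u ⬝ᵥ (J *ᵥ u)) = -(u ⬝ᵥ (A *ᵥ u)) - (t ^ e) ^ 3 * (u ⬝ᵥ (B *ᵥ u)) := by linarith
  rw [‹t ^ (d₀ + e) = _›, ‹t ^ (d₀ + 3 * e) = _›]
  have h3 : (↑(d₀) + ↑e : ℝ) * (t ^ d₀ * t ^ e) * (u ⬝ᵥ (J *ᵥ u))
      = (↑d₀ + ↑e) * t ^ d₀ * (t ^ e * (u ⬝ᵥ (J *ᵥ u))) := by ring
  rw [h3, hJ]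
  ring

/-- **THE TWO-SIDED THREE-LETTER LAW, census currency.**  For the real symmetric lacunary pencil
`F(X) = X^d A + X^{d+e} J + X^{d+3e} B` (`A ⪰ 0`, `B ⪰ 0`, `J` arbitrary symmetric, `e ≥ 1`): any finite set `T` of
positive roots of `det F` at each of which some kernel vector `u` has an INCREASING Rayleigh polynomial (`P_u′(t) > 0`,
the inertia kit's POSITIVE TYPE) has `#T ≤ rank B ≤ m`. [folklore] -/
theorem card_posType_roots_le (A J B : Matrix (Fin m) (Fin m) ℝ) (hA : A.PosSemidef) (hJ : J.IsSymm) (hB : B.PosSemidef)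
    (d₀ e : ℕ) (he : 0 < e) (T : Finset ℝ) (hT : ∀ t ∈ T, 0 < t)
    (hroot : ∀ t ∈ T, ∃ u : Fin m → ℝ, (∑ k : Fin 3, t ^ (![d₀, d₀ + e, d₀ + 3 * e] k) • (![A, J, B] k)) *ᵥ u = 0 ∧
      0 < (derivative (∑ k : Fin 3, C (u ⬝ᵥ ((![A, J, B] k) *ᵥ u)) * (X : ℝ[X]) ^ (![d₀, d₀ + e, d₀ + 3 * e] k))).eval t) :
    T.card ≤ B.rank := by
  classical
  choose! u hu using hroot
  have h := card_posType_le_rank (I := T) A J B hA hJ hB e (fun t => (t : ℝ)) (fun t => hT t t.2)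
    Subtype.coe_injective he (fun t => u t) (fun t => reduced_kernel A J B d₀ e (hT t t.2) _ (hu t t.2).1) ?_
  · simpa using h
  · intro t
    have ht := hT t t.2
    have hpos := (hu t t.2).2
    have heq := rayleigh_deriv_eq A J B d₀ e ht _ (hu t t.2).1
    have h1 : 0 < t * (derivative (∑ k : Fin 3, C (u t ⬝ᵥ ((![A, J, B] k) *ᵥ u t)) *
        (X : ℝ[X]) ^ (![d₀, d₀ + e, d₀ + 3 * e] k))).eval (t : ℝ) := mul_pos ht hpos
    rw [heq] at h1
    have h2 : 0 < (e : ℝ) * (t : ℝ) ^ d₀ := mul_pos (Nat.cast_pos.mpr he) (pow_pos ht _)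
    have h3 : 0 < 2 * ((t : ℝ) ^ e) ^ 3 * (u t ⬝ᵥ (B *ᵥ u t)) - u t ⬝ᵥ (A *ᵥ u t) := by
      by_contra hcon
      push Not at hcon
      have := mul_nonpos_of_nonneg_of_nonpos h2.le hcon
      linarith
    linarith

/-- **THE `2m` LAW FOR SIMPLE CROSSINGS** (two-sided three-letter word, supports `(d, d+e, d+3e)`).  Let `A ≻ 0`, `B ≻ 0`,
`J` symmetric, `e ≥ 1`, `F(X) = X^d A + X^{d+e} J + X^{d+3e} B`, and suppose every positive root of `det F` is a SIMPLE
CROSSING in the sense of the inertia kit: its kernel is one-dimensional and of definite type (every non-zero kernel vector has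
`P_u′(t) ≠ 0` of one sign; by `Multiplicity.rootMultiplicity_det_pencil_eq_one` these are exactly simple roots).  Then the
positive roots of `det F` counted with multiplicity — hence also the distinct ones — number AT MOST `2m`
(`= 2·N⁺ ≤ 2·rank B` by `Inertia.global_index_formula` with `ν(A) = ν(B) = 0` and `card_posType_roots_le`).  At `m = 3` on
`(0,1,3)` the Descartes ceiling with theory signs is `8`; the cell's located maximum is `6 = 2m`.  STATUS OF THE HYPOTHESES (desk
R3002): `hcorank`/`htype` are genericity conditions that travel with the statement; every located maximiser of the cell's zero-forcing
instrument (m = 2, 3, 4) has only SIMPLE roots (types alternating `−,+,…`, exp/check_gram.py), so it satisfies them; WITHOUT them this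
theorem says nothing — part D (`…TwoSidedThreeLettersDefinite`) removes `hcorank` (definite type of any corank suffices); roots with a
NEUTRAL kernel vector (`P_u′(t) = 0`) are not covered by any file of this series. [folklore] -/
theorem card_posRoots_le_two_mul (A J B : Matrix (Fin m) (Fin m) ℝ) (hA : A.PosDef) (hJ : J.IsSymm) (hB : B.PosDef)
    (d₀ e : ℕ) (he : 0 < e)
    (hcorank : ∀ t : ℝ, 0 < t → (∑ k : Fin 3, t ^ (![d₀, d₀ + e, d₀ + 3 * e] k) • (![A, J, B] k)).det = 0 →
      (∑ k : Fin 3, t ^ (![d₀, d₀ + e, d₀ + 3 * e] k) • (![A, J, B] k)).rank + 1 = m)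
    (htype : ∀ t : ℝ, 0 < t → (∑ k : Fin 3, t ^ (![d₀, d₀ + e, d₀ + 3 * e] k) • (![A, J, B] k)).det = 0 →
      (∀ u : Fin m → ℝ, (∑ k : Fin 3, t ^ (![d₀, d₀ + e, d₀ + 3 * e] k) • (![A, J, B] k)) *ᵥ u = 0 → u ≠ 0 →
        (derivative (∑ k : Fin 3, C (u ⬝ᵥ ((![A, J, B] k) *ᵥ u)) * (X : ℝ[X]) ^ (![d₀, d₀ + e, d₀ + 3 * e] k))).eval t < 0) ∨
      (∀ u : Fin m → ℝ, (∑ k : Fin 3, t ^ (![d₀, d₀ + e, d₀ + 3 * e] k) • (![A, J, B] k)) *ᵥ u = 0 → u ≠ 0 →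
        0 < (derivative (∑ k : Fin 3, C (u ⬝ᵥ ((![A, J, B] k) *ᵥ u)) * (X : ℝ[X]) ^ (![d₀, d₀ + e, d₀ + 3 * e] k))).eval t)) :
    Multiset.card ((Matrix.det (∑ k : Fin 3, ((X : ℝ[X]) ^ (![d₀, d₀ + e, d₀ + 3 * e] k)) • (![A, J, B] k).map C)).roots.filter
        (fun t => 0 < t)) ≤ 2 * m := by
  classical
  set dv : Fin 3 → ℕ := ![d₀, d₀ + e, d₀ + 3 * e] with hdv
  set Sv : Fin 3 → Matrix (Fin m) (Fin m) ℝ := ![A, J, B] with hSv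
  have hAs : A.IsSymm := by
    have h1 := hA.1; unfold Matrix.IsHermitian at h1
    rwa [Matrix.conjTranspose_eq_transpose_of_trivial] at h1
  have hBs : B.IsSymm := by
    have h1 := hB.1; unfold Matrix.IsHermitian at h1
    rwa [Matrix.conjTranspose_eq_transpose_of_trivial] at h1
  have hS : ∀ k, (Sv k).IsSymm := by
    intro k; fin_cases k
    · exact hAs
    · exact hJ
    · exact hBs
  have hmin : ∀ l : Fin 3, l ≠ 0 → dv 0 < dv l := by
    intro l hl; fin_cases l
    · exact absurd rfl hl
    · show d₀ < d₀ + e; omega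
    · show d₀ < d₀ + 3 * e; omega
  have hmax : ∀ l : Fin 3, l ≠ 2 → dv l < dv 2 := by
    intro l hl; fin_cases l
    · show d₀ < d₀ + 3 * e; omega
    · show d₀ + e < d₀ + 3 * e; omega
    · exact absurd rfl hl
  have h0 : (Sv 0).det ≠ 0 := by show A.det ≠ 0; exact hA.det_pos.ne'
  have h2 : (Sv 2).det ≠ 0 := by show B.det ≠ 0; exact hB.det_pos.ne'
  -- the negative-type predicate
  let negType : ℝ → Prop := fun t => ∀ u : Fin m → ℝ, (∑ k, t ^ dv k • Sv k) *ᵥ u = 0 → u ≠ 0 →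
    (derivative (∑ k, C (u ⬝ᵥ (Sv k *ᵥ u)) * (X : ℝ[X]) ^ dv k)).eval t < 0
  obtain ⟨hidx, -, hsum⟩ := Inertia.global_index_formula dv Sv hS 0 2 hmin hmax h0 h2 htype negType
    (fun t _ _ => Iff.rfl)
  -- `ν(A) = ν(B) = 0`
  have hνA : Fintype.card {j // (Inertia.isHermitian_of_isSymm (hS 0)).eigenvalues j < 0} = 0 := by
    rw [Fintype.card_eq_zero_iff]
    refine ⟨fun ⟨j, hj⟩ => ?_⟩
    have hp : 0 < (Inertia.isHermitian_of_isSymm (hS 0)).eigenvalues j := hA.eigenvalues_pos j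
    linarith
  have hνB : Fintype.card {j // (Inertia.isHermitian_of_isSymm (hS 2)).eigenvalues j < 0} = 0 := by
    rw [Fintype.card_eq_zero_iff]
    refine ⟨fun ⟨j, hj⟩ => ?_⟩
    have hp : 0 < (Inertia.isHermitian_of_isSymm (hS 2)).eigenvalues j := hB.eigenvalues_pos j
    linarith
  rw [hνA, hνB, zero_add, zero_add] at hidx
  -- abbreviations
  set P := Matrix.det (∑ k, ((X : ℝ[X]) ^ dv k) • (Sv k).map C) with hP
  have hdef : ∀ t : ℝ, 0 < t → (∑ k, t ^ dv k • Sv k).det = 0 → ∀ v : Fin m → ℝ, (∑ k, t ^ dv k • Sv k) *ᵥ v = 0 →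
      v ≠ 0 → (derivative (∑ k, C (v ⬝ᵥ (Sv k *ᵥ v)) * (X : ℝ[X]) ^ dv k)).eval t ≠ 0 := by
    intro t ht hdet v hv hv0
    rcases htype t ht hdet with h | h
    · exact ne_of_lt (h v hv hv0)
    · exact ne_of_gt (h v hv hv0)
  -- the positive-type positive roots form a multiset WITHOUT repetition (simple crossings have multiplicity one)
  set q : ℝ → Prop := fun t => 0 < t ∧ ¬ negType t with hq
  have hnodup : (P.roots.filter q).Nodup := by
    rw [Multiset.nodup_iff_count_le_one]
    intro a
    by_cases hqa : q a
    · rw [Multiset.count_filter_of_pos hqa, count_roots]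
      by_cases hr : (∑ k, a ^ dv k • Sv k).det = 0
      · have h1 := Multiplicity.rootMultiplicity_det_pencil_eq_one dv Sv hS a
          (by rw [Fintype.card_fin]; exact hcorank a hqa.1 hr) (hdef a hqa.1 hr)
        rw [← hP] at h1
        omega
      · have hnr : ¬ P.IsRoot a := by
          intro hroot
          apply hr
          have h1 : P.eval a = 0 := hroot
          rwa [hP, DefiniteMoments.eval_det_pencil] at h1
        rw [Polynomial.rootMultiplicity_eq_zero hnr]
        exact zero_le_one
    · rw [Multiset.count_filter_of_neg hqa]
      exact zero_le_one
  set T := (P.roots.filter q).toFinset with hTdef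
  have hTcard : T.card = Multiset.card (P.roots.filter q) := Multiset.toFinset_card_of_nodup hnodup
  -- every element of `T` is a positive root with a positive-type kernel vector
  have hTpos : ∀ t ∈ T, 0 < t := fun t ht => (Multiset.mem_filter.mp (Multiset.mem_toFinset.mp ht)).2.1
  have hTroot : ∀ t ∈ T, ∃ u : Fin m → ℝ, (∑ k : Fin 3, t ^ (dv k) • (Sv k)) *ᵥ u = 0 ∧
      0 < (derivative (∑ k : Fin 3, C (u ⬝ᵥ ((Sv k) *ᵥ u)) * (X : ℝ[X]) ^ (dv k))).eval t := by
    intro t ht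
    obtain ⟨hmem, htq⟩ := Multiset.mem_filter.mp (Multiset.mem_toFinset.mp ht)
    obtain ⟨hP0, hroot⟩ := (Polynomial.mem_roots').mp hmem
    have hdet : (∑ k, t ^ dv k • Sv k).det = 0 := by
      have h1 : P.eval t = 0 := hroot
      rwa [hP, DefiniteMoments.eval_det_pencil] at h1
    obtain ⟨u, hu0, hu⟩ := Matrix.exists_mulVec_eq_zero_iff.mpr hdet
    refine ⟨u, hu, ?_⟩
    rcases htype t htq.1 hdet with hneg | hposT
    · exact absurd hneg htq.2
    · exact hposT u hu hu0
  have hTle : T.card ≤ B.rank := card_posType_roots_le A J B hA.posSemidef hJ hB.posSemidef d₀ e he T hTpos hTroot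
  have hBm : B.rank ≤ m := (Matrix.rank_le_width B).trans le_rfl
  -- assemble: `Z₊ = N⁻ + N⁺ = 2 N⁺ ≤ 2 rank B ≤ 2m`
  rw [← hsum]
  have hN : Multiset.card (P.roots.filter q) ≤ m := by rw [← hTcard]; exact hTle.trans hBm
  have hidx' : Multiset.card (P.roots.filter fun t => 0 < t ∧ negType t) = Multiset.card (P.roots.filter q) :=
    hidx.symm
  rw [hidx']
  omega

/-- **THE `2m` LAW, distinct roots** (census currency `roots.toFinset.filter (0 < ·)`): under the hypotheses of
`card_posRoots_le_two_mul` the determinant has at most `2m` distinct positive zeros. [folklore] -/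
theorem card_posRoots_finset_le_two_mul (A J B : Matrix (Fin m) (Fin m) ℝ) (hA : A.PosDef) (hJ : J.IsSymm) (hB : B.PosDef)
    (d₀ e : ℕ) (he : 0 < e)
    (hcorank : ∀ t : ℝ, 0 < t → (∑ k : Fin 3, t ^ (![d₀, d₀ + e, d₀ + 3 * e] k) • (![A, J, B] k)).det = 0 →
      (∑ k : Fin 3, t ^ (![d₀, d₀ + e, d₀ + 3 * e] k) • (![A, J, B] k)).rank + 1 = m)
    (htype : ∀ t : ℝ, 0 < t → (∑ k : Fin 3, t ^ (![d₀, d₀ + e, d₀ + 3 * e] k) • (![A, J, B] k)).det = 0 →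
      (∀ u : Fin m → ℝ, (∑ k : Fin 3, t ^ (![d₀, d₀ + e, d₀ + 3 * e] k) • (![A, J, B] k)) *ᵥ u = 0 → u ≠ 0 →
        (derivative (∑ k : Fin 3, C (u ⬝ᵥ ((![A, J, B] k) *ᵥ u)) * (X : ℝ[X]) ^ (![d₀, d₀ + e, d₀ + 3 * e] k))).eval t < 0) ∨
      (∀ u : Fin m → ℝ, (∑ k : Fin 3, t ^ (![d₀, d₀ + e, d₀ + 3 * e] k) • (![A, J, B] k)) *ᵥ u = 0 → u ≠ 0 →
        0 < (derivative (∑ k : Fin 3, C (u ⬝ᵥ ((![A, J, B] k) *ᵥ u)) * (X : ℝ[X]) ^ (![d₀, d₀ + e, d₀ + 3 * e] k))).eval t)) :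
    ((Matrix.det (∑ k : Fin 3, ((X : ℝ[X]) ^ (![d₀, d₀ + e, d₀ + 3 * e] k)) • (![A, J, B] k).map C)).roots.toFinset.filter
        (fun t => 0 < t)).card ≤ 2 * m := by
  classical
  have h := card_posRoots_le_two_mul A J B hA hJ hB d₀ e he hcorank htype
  refine le_trans ?_ h
  rw [← Multiset.toFinset_filter]
  exact Multiset.toFinset_card_le _

end Census

end TwoSidedThree

end Summit.ValiantsHypothesis.ValiantsHypothesis.Theorems.KPlusLogSqLaw.TowerGraft
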